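import Literature.Probability.LatticeModels.CriticalUrsellFourSign
import HarnessLib

/-!
# Uniform convergence of the rescaled critical Ursell function on compact sets

Topic `Probability/LatticeModels`; family `crit-ising`. THEOREM-ONLY leaf file (no definitions, no
named facts). For a pointwise scaling limit `S` of the critical Ising correlators on `ℤ^d`, `d ≥ 3`
(`HasPointwiseScalingLimit (criticalCorr d) ρ S`: `ρ(δ)^n ⟨∏ σ_{[xᵢ/δ]}⟩_{β_c} → S n x` locally
uniformly on non-coincident configurations):

* `tendstoUniformlyOn_rescaled_criticalUrsellFour` — the rescaled lattice Ursell function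
  `ρ(δ)⁴ U₄^{lat}([x/δ])` converges to `U₄^S(x) = limitConnectedFour S x` UNIFORMLY on every compact
  set of non-coincident quadruples (the uniform form of `tendsto_rescaled_criticalUrsellFour`:
  locally uniform convergence is uniform on compacts, `tendstoLocallyUniformlyOn_iff_forall_isCompact`,
  and products of uniformly convergent, uniformly bounded real functions converge uniformly);
* `eventually_forall_far_rescaled_ursellFour_le` — if moreover `U₄^S ≡ 0` (a Gaussian limit), then
  along the meshes `δ = 1/L`, for all large `L`, `ρ(1/L)⁴ |U₄^{lat}(y)| ≤ ε` simultaneously for all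
  quadruples `y` of lattice points in `Λ_L` at mutual sup-distances `> ηL` (these rescale into the
  compact set `{|zᵢₖ| ≤ 1, ‖zᵢ - zⱼ‖ ≥ η}` of non-coincident configurations, on which `[Lz/L] = y`
  exactly).

This is the "far region" input of the dimension count of Aizenman (CDM 2020, §10.1) in its uniform
form, as needed for block (Binder-cumulant) sums `Σ_{Λ_L⁴} U₄`.

## References

* M. Aizenman, *A geometric perspective on the scaling limits of critical Ising and `φ⁴_d` models*,
  CDM 2020 (arXiv:2112.04248), §10.1 eqs. (10.1)–(10.2) [AizenmanCDM2020].

## Mathlib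

`tendstoLocallyUniformlyOn_iff_forall_isCompact`, `TendstoUniformlyOn.comp/mono/congr/add/sub`,
`Metric.tendstoUniformlyOn_iff`, `isCompact_univ_pi`, `isCompact_Icc`, `PiLp.norm_apply_le`,
`tendsto_one_div_atTop_nhds_zero_nat`.
-/

noncomputable section

namespace Literature.Probability.LatticeModels

open Filter Finset
open scoped _root_.Topology

variable {d : ℕ}

/-! ### Two elementary facts on uniform convergence of real functions -/

/-- Products of uniformly convergent real functions with bounded limits converge uniformly to the
product of the limits. [folklore] -/
theorem tendstoUniformlyOn_mul_of_abs_le {ι α : Type*} {p : Filter ι} {f g : ι → α → ℝ}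
    {F G : α → ℝ} {K : Set α} {M₁ M₂ : ℝ} (hM₁ : 0 ≤ M₁) (hM₂ : 0 ≤ M₂)
    (hf : TendstoUniformlyOn f F p K) (hg : TendstoUniformlyOn g G p K)
    (hF : ∀ z ∈ K, |F z| ≤ M₁) (hG : ∀ z ∈ K, |G z| ≤ M₂) :
    TendstoUniformlyOn (fun i z => f i z * g i z) (fun z => F z * G z) p K := by
  rw [Metric.tendstoUniformlyOn_iff] at hf hg ⊢
  intro ε hε
  obtain ⟨ε₁, hε₁⟩ : ∃ ε₁ : ℝ, ε₁ = min 1 (ε / (M₁ + M₂ + 2)) := ⟨_, rfl⟩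
  have hε₁pos : 0 < ε₁ := by rw [hε₁]; exact lt_min one_pos (by positivity)
  have hε₁1 : ε₁ ≤ 1 := by rw [hε₁]; exact min_le_left _ _
  have hε₁2 : ε₁ ≤ ε / (M₁ + M₂ + 2) := by rw [hε₁]; exact min_le_right _ _
  filter_upwards [hf ε₁ hε₁pos, hg ε₁ hε₁pos] with i hfi hgi z hz
  have h1 := hfi z hz
  have h2 := hgi z hz
  rw [Real.dist_eq] at h1 h2 ⊢
  have hFz := hF z hz
  have hGz := hG z hz
  have key : F z * G z - f i z * g i z = F z * (G z - g i z) + (F z - f i z) * g i z := by ring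
  have hg' : |g i z| ≤ M₂ + 1 := by
    have : |g i z| ≤ |G z| + |G z - g i z| := by
      calc |g i z| = |G z - (G z - g i z)| := by ring_nf
        _ ≤ |G z| + |G z - g i z| := abs_sub _ _
    linarith
  have h3 : ε₁ * (M₁ + M₂ + 2) ≤ ε := by rwa [le_div_iff₀ (by positivity)] at hε₁2
  calc |F z * G z - f i z * g i z| = |F z * (G z - g i z) + (F z - f i z) * g i z| := by rw [key]
    _ ≤ |F z * (G z - g i z)| + |(F z - f i z) * g i z| := abs_add_le _ _
    _ = |F z| * |G z - g i z| + |F z - f i z| * |g i z| := by rw [abs_mul, abs_mul]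
    _ ≤ M₁ * ε₁ + ε₁ * (M₂ + 1) :=
        add_le_add (mul_le_mul hFz h2.le (abs_nonneg _) hM₁)
          (mul_le_mul h1.le hg' (abs_nonneg _) hε₁pos.le)
    _ = ε₁ * (M₁ + M₂ + 1) := by ring
    _ < ε := by nlinarith

/-- The limit of a uniformly convergent family of real functions, each bounded on `K`, is bounded on
`K`. [folklore] -/
theorem exists_forall_abs_le_of_tendstoUniformlyOn {ι α : Type*} {p : Filter ι} [p.NeBot]
    {f : ι → α → ℝ} {F : α → ℝ} {K : Set α} (hf : TendstoUniformlyOn f F p K)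
    (hb : ∀ i, ∃ B, ∀ z ∈ K, |f i z| ≤ B) : ∃ M, 0 ≤ M ∧ ∀ z ∈ K, |F z| ≤ M := by
  have h1 := Metric.tendstoUniformlyOn_iff.1 hf 1 one_pos
  obtain ⟨i, hi⟩ := h1.exists
  obtain ⟨B, hB⟩ := hb i
  refine ⟨|B| + 1, by positivity, fun z hz => ?_⟩
  have h := hi z hz
  rw [Real.dist_eq] at h
  have hBz := hB z hz
  calc |F z| = |(F z - f i z) + f i z| := by ring_nf
    _ ≤ |F z - f i z| + |f i z| := abs_add_le _ _
    _ ≤ |B| + 1 := by linarith [le_abs_self B]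

/-! ### Uniform convergence of the rescaled pair and Ursell functions on compacts -/

/-- For a pointwise scaling limit of the critical correlators and a compact set `K` of non-coincident
quadruples, the rescaled pair correlator of the points `i ≠ j`, `ρ(δ)² ⟨σ_{[zᵢ/δ]}σ_{[zⱼ/δ]}⟩_{β_c}`,
converges to `S₂(zᵢ, zⱼ)` uniformly in `z ∈ K` (uniform convergence on the compact image
`{(zᵢ, zⱼ) : z ∈ K} ⊆ NonCoincident d 2`). [cite: AizenmanCDM2020, §10.1 eq. (10.1)] -/
theorem tendstoUniformlyOn_rescaled_two_pair {ρ : ℝ → ℝ} {S : CorrFamily d}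
    (hlim : HasPointwiseScalingLimit (criticalCorr d) ρ S)
    {K : Set (Fin 4 → EuclideanSpace ℝ (Fin d))} (hK : IsCompact K) (hKs : K ⊆ NonCoincident d 4)
    {i j : Fin 4} (hij : i ≠ j) :
    TendstoUniformlyOn
      (fun δ z => ρ δ ^ 2 * criticalCorr d 2 ![latticeApprox δ (z i), latticeApprox δ (z j)])
      (fun z => S 2 ![z i, z j]) (𝓝[>] (0 : ℝ)) K := by
  set g : (Fin 4 → EuclideanSpace ℝ (Fin d)) → (Fin 2 → EuclideanSpace ℝ (Fin d)) :=
    fun z => ![z i, z j] with hg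
  have hgc : Continuous g :=
    (continuous_apply i).matrixVecCons ((continuous_apply j).matrixVecCons continuous_const)
  have hK2 : IsCompact (g '' K) := hK.image hgc
  have hK2s : g '' K ⊆ NonCoincident d 2 := by
    rintro _ ⟨z, hz, rfl⟩
    exact pair_mem_nonCoincident fun h => hij (hKs hz h)
  have hU : TendstoUniformlyOn (rescaledCorrelator (criticalCorr d) ρ 2) (S 2) (𝓝[>] 0) (g '' K) :=
    (tendstoLocallyUniformlyOn_iff_forall_isCompact (isOpen_nonCoincident d 2)).1 (hlim 2)
      (g '' K) hK2s hK2
  have hU' := (hU.comp g).mono (fun z hz => ⟨z, hz, rfl⟩ : K ⊆ g ⁻¹' (g '' K))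
  have e1 : S 2 ∘ g = fun z => S 2 ![z i, z j] := rfl
  rw [e1] at hU'
  refine hU'.congr (Eventually.of_forall fun δ => ?_)
  intro z _
  show rescaledCorrelator (criticalCorr d) ρ 2 δ (g z) = _
  rw [rescaledCorrelator_apply, latticeApprox_comp_two]
  simp [hg]

/-- **Uniform convergence of the rescaled Ursell function on compacts.** For a pointwise scaling
limit `S` of the critical correlators on `ℤ^d`, `d ≥ 3`, and every compact set `K` of non-coincident
quadruples, `ρ(δ)⁴ U₄^{lat}([z/δ]) → U₄^S(z)` uniformly in `z ∈ K` as `δ → 0⁺`, where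
`U₄^{lat}(y) = ⟨σ_{y₀}σ_{y₁}σ_{y₂}σ_{y₃}⟩_{β_c} - ∑_{pairings} ⟨σσ⟩_{β_c}⟨σσ⟩_{β_c}` and
`U₄^S = limitConnectedFour S` (the `n = 4` clause on `K`, the `n = 2` clause on the six compact pair
images, and products of uniformly convergent bounded functions; the pair limits are bounded on `K`
because `|⟨σσ⟩| ≤ 1`). [cite: AizenmanCDM2020, §10.1 eqs. (10.1)–(10.2)] -/
theorem tendstoUniformlyOn_rescaled_criticalUrsellFour (hd : 3 ≤ d) {ρ : ℝ → ℝ} {S : CorrFamily d}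
    (hlim : HasPointwiseScalingLimit (criticalCorr d) ρ S)
    {K : Set (Fin 4 → EuclideanSpace ℝ (Fin d))} (hK : IsCompact K) (hKs : K ⊆ NonCoincident d 4) :
    TendstoUniformlyOn (fun δ z => ρ δ ^ 4 * (criticalCorr d 4 (fun k => latticeApprox δ (z k)) -
      (criticalCorr d 2 ![latticeApprox δ (z 0), latticeApprox δ (z 1)] *
          criticalCorr d 2 ![latticeApprox δ (z 2), latticeApprox δ (z 3)]
        + criticalCorr d 2 ![latticeApprox δ (z 0), latticeApprox δ (z 2)] *
          criticalCorr d 2 ![latticeApprox δ (z 1), latticeApprox δ (z 3)]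
        + criticalCorr d 2 ![latticeApprox δ (z 0), latticeApprox δ (z 3)] *
          criticalCorr d 2 ![latticeApprox δ (z 1), latticeApprox δ (z 2)])))
      (limitConnectedFour S) (𝓝[>] (0 : ℝ)) K := by
  have h4 : TendstoUniformlyOn
      (fun δ z => ρ δ ^ 4 * criticalCorr d 4 (fun k => latticeApprox δ (z k))) (S 4) (𝓝[>] 0) K :=
    (tendstoLocallyUniformlyOn_iff_forall_isCompact (isOpen_nonCoincident d 4)).1 (hlim 4) K hKs hK
  have hp : ∀ i j : Fin 4, i ≠ j → TendstoUniformlyOn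
      (fun δ z => ρ δ ^ 2 * criticalCorr d 2 ![latticeApprox δ (z i), latticeApprox δ (z j)])
      (fun z => S 2 ![z i, z j]) (𝓝[>] (0 : ℝ)) K := fun i j hij =>
    tendstoUniformlyOn_rescaled_two_pair hlim hK hKs hij
  have hb : ∀ i j : Fin 4, i ≠ j → ∃ M, 0 ≤ M ∧ ∀ z ∈ K, |S 2 ![z i, z j]| ≤ M := fun i j hij =>
    exists_forall_abs_le_of_tendstoUniformlyOn (hp i j hij) fun δ => ⟨ρ δ ^ 2, fun z _ => by
      rw [abs_mul, abs_of_nonneg (sq_nonneg _)]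
      exact mul_le_of_le_one_right (sq_nonneg _) (abs_criticalCorr_le_one hd _ _)⟩
  obtain ⟨M01, hM01, h01⟩ := hb 0 1 (by decide)
  obtain ⟨M23, hM23, h23⟩ := hb 2 3 (by decide)
  obtain ⟨M02, hM02, h02⟩ := hb 0 2 (by decide)
  obtain ⟨M13, hM13, h13⟩ := hb 1 3 (by decide)
  obtain ⟨M03, hM03, h03⟩ := hb 0 3 (by decide)
  obtain ⟨M12, hM12, h12⟩ := hb 1 2 (by decide)
  have key := h4.sub
    (((tendstoUniformlyOn_mul_of_abs_le hM01 hM23 (hp 0 1 (by decide)) (hp 2 3 (by decide))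
      h01 h23).add
    (tendstoUniformlyOn_mul_of_abs_le hM02 hM13 (hp 0 2 (by decide)) (hp 1 3 (by decide))
      h02 h13)).add
    (tendstoUniformlyOn_mul_of_abs_le hM03 hM12 (hp 0 3 (by decide)) (hp 1 2 (by decide))
      h03 h12))
  refine (key.congr (Eventually.of_forall fun δ => ?_)).congr_right ?_
  · intro z _
    simp only [Pi.sub_apply, Pi.add_apply]
    ring
  · intro z _
    simp only [Pi.sub_apply, Pi.add_apply]
    rfl

/-! ### The Gaussian case along `δ = 1/L`: far lattice quadruples in a block -/

/-- **Far quadruples of a block have uniformly small rescaled Ursell function when the limit is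
Gaussian.** Let `S` be a pointwise scaling limit of the critical correlators on `ℤ^d`, `d ≥ 3`, with
`U₄^S ≡ 0` on non-coincident configurations. Then for `η, ε > 0` and all large `L`: every quadruple
`y` of sites of `Λ_L` at mutual sup-distances `> ηL` has `ρ(1/L)⁴ |U₄^{lat}(y)| ≤ ε`. (The points
`zᵢ = yᵢ/L` range in the compact set `{z : |zᵢₖ| ≤ 1, ‖zᵢ - zⱼ‖ ≥ η (i ≠ j)} ⊆ NonCoincident d 4`,
on which `ρ(δ)⁴U₄^{lat}([z/δ]) → 0` uniformly, and `[zᵢ/(1/L)] = yᵢ` exactly.)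
[cite: AizenmanCDM2020, §10.1 eqs. (10.1)–(10.2)] -/
theorem eventually_forall_far_rescaled_ursellFour_le (hd : 3 ≤ d) {ρ : ℝ → ℝ} {S : CorrFamily d}
    (hlim : HasPointwiseScalingLimit (criticalCorr d) ρ S) (hU4 : ¬ HasNontrivialU4 S)
    {η ε : ℝ} (hη : 0 < η) (hε : 0 < ε) :
    ∀ᶠ L : ℕ in atTop, ∀ y : Fin 4 → Site d, (∀ i, y i ∈ box d L) →
      (∀ i j, i ≠ j → η * L < Site.supNorm (y i - y j)) →
      ρ (1 / (L : ℝ)) ^ 4 * |criticalCorr d 4 y -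
        (criticalCorr d 2 ![y 0, y 1] * criticalCorr d 2 ![y 2, y 3]
          + criticalCorr d 2 ![y 0, y 2] * criticalCorr d 2 ![y 1, y 3]
          + criticalCorr d 2 ![y 0, y 3] * criticalCorr d 2 ![y 1, y 2])| ≤ ε := by
  classical
  have hd1 : 1 ≤ d := by omega
  -- the compact set of rescaled far configurations
  set C₁ : Set (EuclideanSpace ℝ (Fin d)) :=
    (WithLp.toLp 2) '' (Set.Icc (-1 : Fin d → ℝ) 1) with hC₁
  have hC₁c : IsCompact C₁ := isCompact_Icc.image (PiLp.continuous_toLp 2 _)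
  set K : Set (Fin 4 → EuclideanSpace ℝ (Fin d)) :=
    {z | ∀ i, z i ∈ C₁} ∩ {z | ∀ i j, i ≠ j → η ≤ ‖z i - z j‖} with hKdef
  have hKc : IsCompact K := by
    refine IsCompact.inter_right ?_ ?_
    · have e : {z : Fin 4 → EuclideanSpace ℝ (Fin d) | ∀ i, z i ∈ C₁} =
          Set.pi Set.univ (fun _ => C₁) := by
        ext z; simp
      rw [e]
      exact isCompact_univ_pi fun _ => hC₁c
    · simp only [Set.setOf_forall]
      refine isClosed_iInter fun i => isClosed_iInter fun j => isClosed_iInter fun _ => ?_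
      exact isClosed_le continuous_const ((continuous_apply i).sub (continuous_apply j)).norm
  have hKs : K ⊆ NonCoincident d 4 := by
    intro z hz i j hzij
    by_contra hij
    have h := hz.2 i j hij
    rw [hzij, sub_self, norm_zero] at h
    exact absurd h (not_le.2 hη)
  -- uniform smallness of the rescaled Ursell function on `K`
  have hU := tendstoUniformlyOn_rescaled_criticalUrsellFour hd hlim hKc hKs
  have hzero : ∀ z ∈ K, limitConnectedFour S z = 0 := by
    intro z hz
    by_contra hne
    exact hU4 ⟨z, hKs hz, hne⟩
  have hev := Metric.tendstoUniformlyOn_iff.1 hU ε hε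
  -- along `δ = 1/L`
  have hδ : Tendsto (fun L : ℕ => 1 / (L : ℝ)) atTop (𝓝[>] (0 : ℝ)) := by
    rw [tendsto_nhdsWithin_iff]
    refine ⟨tendsto_one_div_atTop_nhds_zero_nat, ?_⟩
    filter_upwards [eventually_ge_atTop 1] with L hL
    have : (0 : ℝ) < L := by exact_mod_cast hL
    exact Set.mem_Ioi.2 (by positivity)
  filter_upwards [hδ.eventually hev, eventually_ge_atTop 1] with L hL hL1 y hy hfar
  have hLpos : (0 : ℝ) < L := by exact_mod_cast hL1
  have hδpos : (0 : ℝ) < 1 / (L : ℝ) := by positivity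
  set z : Fin 4 → EuclideanSpace ℝ (Fin d) := fun i => (1 / (L : ℝ)) • siteVec (y i) with hz
  have hzy : ∀ i, latticeApprox (1 / (L : ℝ)) (z i) = y i := fun i =>
    latticeApprox_smul_siteVec hδpos (y i)
  have hzK : z ∈ K := by
    refine ⟨fun i => ?_, fun i j hij => ?_⟩
    · refine ⟨(1 / (L : ℝ)) • fun k => (y i k : ℝ), ?_, ?_⟩
      · rw [Set.mem_Icc]
        have hb := fun k => mem_box.1 (hy i) k
        constructor
        · intro k
          simp only [Pi.smul_apply, smul_eq_mul, Pi.neg_apply, Pi.one_apply]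
          have h1 : (-(L : ℝ)) ≤ (y i k : ℝ) := by exact_mod_cast (hb k).1
          rw [one_div, le_inv_mul_iff₀ hLpos]
          linarith
        · intro k
          simp only [Pi.smul_apply, smul_eq_mul, Pi.one_apply]
          have h2 : (y i k : ℝ) ≤ L := by exact_mod_cast (hb k).2
          rw [one_div, inv_mul_le_iff₀ hLpos]
          linarith
      · rfl
    · obtain ⟨k, hk⟩ := Site.exists_natAbs_eq_supNorm ⟨⟨0, hd1⟩, Finset.mem_univ _⟩ (y i - y j)
      have h1 : η * L < Site.supNorm (y i - y j) := hfar i j hij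
      have hsup : (Site.supNorm (y i - y j) : ℝ) = |(((y i - y j) k : ℤ) : ℝ)| := by
        rw [← hk, ← Int.cast_abs, ← Int.natCast_natAbs, Int.cast_natCast]
      have hcast : (((y i - y j) k : ℤ) : ℝ) = (y i k : ℝ) - (y j k : ℝ) := by
        push_cast [Pi.sub_apply]; ring
      have hzk : (z i - z j) k = ((y i k : ℝ) - (y j k : ℝ)) / L := by
        simp only [hz, PiLp.sub_apply, PiLp.smul_apply, siteVec_apply, smul_eq_mul]
        ring
      have hcoord : η ≤ ‖(z i - z j) k‖ := by
        rw [hzk, Real.norm_eq_abs, abs_div, abs_of_pos hLpos, le_div_iff₀ hLpos, ← hcast, ← hsup]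
        exact h1.le
      exact hcoord.trans (PiLp.norm_apply_le (z i - z j) k)
  have h := hL z hzK
  rw [hzero z hzK, Real.dist_eq, zero_sub, abs_neg] at h
  simp only [hzy] at h
  rw [abs_mul, abs_of_nonneg (by positivity : (0 : ℝ) ≤ ρ (1 / (L : ℝ)) ^ 4)] at h
  exact h.le

end Literature.Probability.LatticeModels

end
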